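import Summits.AtomisticToContinuum.HydrodynamicLimit.Theses.TwoClocks
import Literature.Analysis.UnboundedOperators.LinearizedBoltzmann

/-!
# Sketch — first lemmas of the crux-idea cards for `TwoClocks.EquilibriumFastWindowLD`
(stmt-AtomisticToContinuum-14440), ideator k = 1, round 1.

Card `holder-defect-doubling`: `windowAvg`, `IsFastObservable`, `WindowPressureStaticBound`,
`TwoWindowHolderDefect` (the transfer target C⁺), `HalvingReduction` (the first lemma: pure
real analysis, provable now).

Card `clamped-corrector-innovations`: `CorrectorStaticBound` (provable statics),
`ClampedAngleInnovationPressure` (transfer target C⁺_Z), `ActivityCensusLD` (clamp price under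
the invariant law).

Nothing here is proved; every declaration is a `Prop` that elaborates over existing tree
declarations.
-/

namespace Summit.AtomisticToContinuum.HydrodynamicLimit.Cruxes.EquilibriumFastWindowLD.Ideas

open MeasureTheory
open Literature.MathematicalPhysics.KineticTheory (T3 V3 hsDiameter localGibbsLaw collide
  hardSphereKernel sphereMeasure)
open Literature.Analysis.FluidPDE (HardSphereFlow Config localMaxwellian)
open Summit.AtomisticToContinuum.HydrodynamicLimit.Theses.TwoClocks (EquilibriumFastWindowLD)

noncomputable section

/-- The hard-sphere flow type of the conjunct at reduced density `σ`, `N + 1` spheres. -/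
abbrev Flow (σ : ℝ) (N : ℕ) : Type :=
  HardSphereFlow (Literature.Analysis.FluidPDE.Torus.geometry (Fin 3)) (hsDiameter σ N) (N + 1)

/-- Window average of the one-body functional `F` over the time window `(s, s + w]` summed over
particles: `Σ_i w⁻¹ ∫_s^{s+w} F((Φ_r z)_i) dr`. For `s = 0` this is literally the exponent of
`EquilibriumFastWindowLD`. -/
def windowAvg (σ : ℝ) (N : ℕ) (Φ : Flow σ N) (F : T3 × V3 → ℝ) (s w : ℝ)
    (z : Config (N + 1) (Fin 3) T3) : ℝ :=
  ∑ i : Fin (N + 1), w⁻¹ * ∫ r in s..(s + w), F ((Φ.flow r z) i)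

/-- The kinetic window `w_N = τ (N+1)^{-1/3}` (≍ τσ² mean free times). -/
def window (τ : ℝ) (N : ℕ) : ℝ := τ * ((N : ℝ) + 1) ^ (-(1 / 3 : ℝ))

/-- The canonical Gibbs law with constant profiles (the flow-invariant reference of the crux). -/
def gibbs (σ a₀ θ₀ : ℝ) (u₀ : V3) (N : ℕ) (Φ : Flow σ N) : Measure (Config (N + 1) (Fin 3) T3) :=
  localGibbsLaw σ (fun _ => a₀) (fun _ => u₀) (fun _ => θ₀) N Φ

/-- `F` is a FAST one-body observable at `(u₀, θ₀)`: continuous, of quadratic growth, and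
`M_{1,u₀,θ₀}`-orthogonal at every `x` to the collision invariants `1, v_j, |v|²` (the hypotheses
of the crux, bundled). -/
def IsFastObservable (θ₀ : ℝ) (u₀ : V3) (F : T3 × V3 → ℝ) : Prop :=
  Continuous F ∧ (∃ C : ℝ, ∀ y, |F y| ≤ C * (1 + ‖y.2‖ ^ 2)) ∧
    (∀ x, ∫ v, F (x, v) * localMaxwellian 1 θ₀ u₀ v = 0) ∧
    (∀ x (j : Fin 3), ∫ v, F (x, v) * v j * localMaxwellian 1 θ₀ u₀ v = 0) ∧
    (∀ x, ∫ v, F (x, v) * ‖v‖ ^ 2 * localMaxwellian 1 θ₀ u₀ v = 0)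

/-! ## Card `holder-defect-doubling` -/

/-- STATIC QUADRATIC BOUND (support, provable now: Jensen in time + flow-invariance of the
canonical Gibbs law + the Gaussian moment generating function of a centred quadratic-growth
observable): the window pressure is at most `C b²` per particle, UNIFORMLY IN THE WINDOW LENGTH
(and already for the un-averaged observable). This is the base case `τ₀` of the doubling
induction; no dynamics enters. -/
def WindowPressureStaticBound : Prop :=
  ∀ (a₀ θ₀ : ℝ) (u₀ : V3), 0 < a₀ → 0 < θ₀ → ∀ σ : ℝ, 0 < σ → σ < 2⁻¹ →
    ∀ (N : ℕ) (Φ : Flow σ N) (F : T3 × V3 → ℝ), IsFastObservable θ₀ u₀ F →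
      ∃ C βs : ℝ, 0 < βs ∧ ∀ b : ℝ, |b| ≤ βs → ∀ τ : ℝ, 0 < τ →
        ∫⁻ z, ENNReal.ofReal (Real.exp (b * windowAvg σ N Φ F 0 (window τ N) z))
            ∂(gibbs σ a₀ θ₀ u₀ N Φ)
          ≤ ENNReal.ofReal (Real.exp (C * b ^ 2 * ((N : ℝ) + 1)))

/-- TRANSFER TARGET C⁺ — SPECIFIC TWO-WINDOW HÖLDER DEFECT ("beat Cauchy–Schwarz by a fixed
exponent"). For some exponent `α < 2` (Cauchy–Schwarz + invariance give `α = 2` for free and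
nothing else), two window averages of a fast observable of common length `w = τ(N+1)^{-1/3}`
separated by the gap `δ w` satisfy, at small coupling `b` and per particle,
`∫ e^{b(Ā₁ + Ā₂)} dG ≤ e^{ε b² (N+1)} (∫ e^{α b Ā₁} dG)^{2/α}` once `τ ≥ τ₀(ε, δ)`,
uniformly in `|b| ≤ β₀`. Deuschel–Stroock's hypermixing condition (H-1) with `n = 2`, read at
the specific (per-particle, exponential-in-`N`) scale and only for one-body window functionals
at small coupling; false for free flight (`σ = 0`, where `Ā₁ = Ā₂`). -/
def TwoWindowHolderDefect : Prop :=
  ∃ σ₀ : ℝ, 0 < σ₀ ∧ ∀ (a₀ θ₀ : ℝ) (u₀ : V3), 0 < a₀ → 0 < θ₀ → ∀ σ : ℝ, 0 < σ → σ < σ₀ →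
    ∀ (Φ : (N : ℕ) → Flow σ N) (F : T3 × V3 → ℝ), IsFastObservable θ₀ u₀ F →
      ∃ α : ℝ, 1 ≤ α ∧ α < 2 ∧ ∃ β₀ : ℝ, 0 < β₀ ∧ ∀ b : ℝ, |b| ≤ β₀ →
        ∀ ε : ℝ, 0 < ε → ∀ δ : ℝ, 0 < δ → ∃ τ₀ : ℝ, 0 < τ₀ ∧ ∀ τ : ℝ, τ₀ ≤ τ →
          ∃ N₀ : ℕ, ∀ N : ℕ, N₀ ≤ N →
            (let w : ℝ := window τ N
             let G := gibbs σ a₀ θ₀ u₀ N (Φ N)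
             ∫⁻ z, ENNReal.ofReal (Real.exp (b * (windowAvg σ N (Φ N) F 0 w z
                    + windowAvg σ N (Φ N) F ((1 + δ) * w) w z))) ∂G
               ≤ ENNReal.ofReal (Real.exp (ε * b ^ 2 * ((N : ℝ) + 1))) *
                   (∫⁻ z, ENNReal.ofReal (Real.exp (α * b * windowAvg σ N (Φ N) F 0 w z)) ∂G)
                     ^ (2 / α))

/-- FIRST LEMMA of the card (pure real analysis; provable now up to interval-integral
bookkeeping on the good set): the doubling inequality
`Λ_{(2+δ)τ}(β) ≤ (2/α) Λ_τ(αβ/2) + (ε/4 + Cδ/2) β²` (Hölder with exponents `(2+δ)/2`,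
`(2+δ)/δ`, the gap priced by the static bound, flow-invariance of `G`) iterates, because
`r = α/2 < 1` and the base case is quadratic, to
`Λ_{τ₀(2+δ)^k}(β) ≤ C β² r^k + (ε/4 + Cδ/2) β²/(1-r)`; hence the crux. -/
def HalvingReduction : Prop :=
  TwoWindowHolderDefect → WindowPressureStaticBound → EquilibriumFastWindowLD

/-! ## Card `clamped-corrector-innovations` -/

/-- STATIC CORRECTOR BOUND (support, provable now): under the canonical Gibbs law velocities
are i.i.d. Maxwellian and independent of the positions, so a centred one-body observable of
LINEAR velocity growth (the growth of the Chapman–Enskog corrector `ĝ = -L⁻¹F` of a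
quadratic-growth `F`, `L` the linearised hard-sphere operator with collision frequency `≍ |v|`)
has Gaussian pressure `≤ C' λ²` per particle for `|λ| ≤ 1`. Prices the two boundary terms
`(β/(τσ²)) [S_ĝ(w) - S_ĝ(0)]` of the corrector identity: pressure `O(β²/(τ²σ⁴)) → 0`. -/
def CorrectorStaticBound : Prop :=
  ∀ (a₀ θ₀ : ℝ) (u₀ : V3), 0 < a₀ → 0 < θ₀ → ∀ σ : ℝ, 0 < σ → σ < 2⁻¹ → ∀ C : ℝ,
    ∃ C' : ℝ, ∀ (N : ℕ) (Φ : Flow σ N) (g : T3 × V3 → ℝ), Continuous g →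
      (∀ y, |g y| ≤ C * (1 + ‖y.2‖)) → (∀ x, ∫ v, g (x, v) * localMaxwellian 1 θ₀ u₀ v = 0) →
        ∀ lam : ℝ, |lam| ≤ 1 →
          ∫⁻ z, ENNReal.ofReal (Real.exp (lam * ∑ i : Fin (N + 1), g (z i)))
              ∂(gibbs σ a₀ θ₀ u₀ N Φ)
            ≤ ENNReal.ofReal (Real.exp (C' * lam ^ 2 * ((N : ℝ) + 1)))

/-- A pair test function `h x (v, v_*) (v', v_*')` is KINEMATICALLY CENTRED if for every
incoming pair its flux-weighted average over the impact direction vanishes — for 3-D hard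
spheres this is the average over the (uniform) outgoing direction: the exact content of "uniform
impact parameter ⇒ isotropic scattering". The angle innovation
`Δ_c(ĝ_i + ĝ_j) − (isotropic mean given the incoming pair)` of the corrector identity is of
this form. -/
def IsKinematicallyCentred (h : T3 → V3 × V3 → V3 × V3 → ℝ) : Prop :=
  ∀ (x : T3) (p : V3 × V3), ∫ ω, hardSphereKernel p ω * h x p (collide ω p) ∂sphereMeasure = 0

/-- TRANSFER TARGET C⁺_Z — CLAMPED ANGLE-INNOVATION PRESSURE. Frame of the crux (universal
`σ₀`, canonical Gibbs law, `w = τ(N+1)^{-1/3}`). Running (adapted) ONE-PARTICLE clamp of particle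
`i` at time `t`: activity so far `a_i(t) = (σ/τ) Σ_{collisions of i in (0,t]} |v_i⁺ − v_i⁻| ≤ V`
AND collision count so far `n_i(t) ≤ V·τ`; `ω_i(t) ∈ {0,1}`. For every continuous, kinematically
centred pair test function `h` of linear growth (the model: particle `fst`'s OWN corrector
increment minus its isotropic mean given the incoming pair,
`h = ĝ(x,v') − ĝ(x,v) − m⁽¹⁾(x; v, v_*)`), the clamped collision sum over ORDERED records
`Σ_c ω_{fst}(t_c) h(x_fst, (v_fst⁻,v_snd⁻), (v_fst⁺,v_snd⁺))` (each unordered collision contributes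
both partners' own terms), at the CLT coupling `β/(τσ²)` (≍ `β/√K` per increment after
`K ≍ σ²τ` collisions per particle), has per-particle pressure `≤ ε` once `τ ≥ τ₀`: the angle
innovations of the deterministic collision stream are sub-Gaussian with variance proxy ∝ the
number of collisions, uniformly in `N`. Pathwise `|coupling × sum| ≤ β C V (1 + speeds)` by the
count clamp, so finiteness is never the issue (quantifier order `∃V₀ ∀V≥V₀ ∃β₀ ∀|β|≤β₀ ∀ε ∃τ₀
∀τ≥τ₀ ∃N₀ ∀N≥N₀` as in the clamped collisional crux). -/
def ClampedAngleInnovationPressure : Prop :=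
  ∃ σ₀ : ℝ, 0 < σ₀ ∧ ∀ (a₀ θ₀ : ℝ) (u₀ : V3), 0 < a₀ → 0 < θ₀ → ∀ σ : ℝ, 0 < σ → σ < σ₀ →
    ∀ (Φ : (N : ℕ) → Flow σ N) (h : T3 → V3 × V3 → V3 × V3 → ℝ),
      Continuous (fun q : T3 × (V3 × V3) × (V3 × V3) => h q.1 q.2.1 q.2.2) →
      (∃ C : ℝ, ∀ x p p', |h x p p'| ≤ C * (1 + ‖p.1‖ + ‖p.2‖)) → IsKinematicallyCentred h →
        ∃ V₀ : ℝ, 0 < V₀ ∧ ∀ V : ℝ, V₀ ≤ V → ∃ β₀ : ℝ, 0 < β₀ ∧ ∀ β : ℝ, |β| ≤ β₀ →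
          ∀ ε : ℝ, 0 < ε → ∃ τ₀ : ℝ, 0 < τ₀ ∧ ∀ τ : ℝ, τ₀ ≤ τ → ∃ N₀ : ℕ, ∀ N : ℕ, N₀ ≤ N →
            (let w : ℝ := window τ N
             let P := gibbs σ a₀ θ₀ u₀ N (Φ N)
             let act := fun (i : Fin (N + 1)) (t : ℝ) (z : Config (N + 1) (Fin 3) T3) =>
               σ / τ * (Φ N).collisionSum (Set.Ioc 0 t)
                 (fun c => if c.fst = i then ‖c.postVel.1 - c.preVel.1‖ else 0) z
             let cnt := fun (i : Fin (N + 1)) (t : ℝ) (z : Config (N + 1) (Fin 3) T3) =>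
               (Φ N).collisionSum (Set.Ioc 0 t) (fun c => if c.fst = i then (1 : ℝ) else 0) z
             let ω := fun (i : Fin (N + 1)) (t : ℝ) (z : Config (N + 1) (Fin 3) T3) =>
               if act i t z ≤ V ∧ cnt i t z ≤ V * τ then (1 : ℝ) else 0
             let Z := fun (z : Config (N + 1) (Fin 3) T3) =>
               (Φ N).collisionSum (Set.Ioc 0 w)
                 (fun c => ω c.fst c.time z * h c.fstPos c.preVel c.postVel) z
             ∫⁻ z, ENNReal.ofReal (Real.exp (β / (τ * σ ^ 2) * Z z)) ∂P
               ≤ ENNReal.ofReal (Real.exp (ε * ((N : ℝ) + 1))))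

/-- CLAMP PRICE UNDER THE INVARIANT LAW (support of the card; an EQUILIBRIUM large-deviation
census, much softer than `CollisionActivityTails`, which is under the true evolution): the
particles whose window activity exceeds `V`, weighted by `1 +` their window-averaged kinetic
energy (the pathwise bound on their uncompensated contribution `w⁻¹∫F`), have per-particle
pressure `≤ ε` at any fixed coupling once `V ≥ V₀(β, ε)` and `τ ≥ τ₀`: a cage of gap `δ'`
costs `≥ 3 log(1/δ')` per member against a gain that no longer grows with `V`. -/
def ActivityCensusLD : Prop :=
  ∃ σ₀ : ℝ, 0 < σ₀ ∧ ∀ (a₀ θ₀ : ℝ) (u₀ : V3), 0 < a₀ → 0 < θ₀ → ∀ σ : ℝ, 0 < σ → σ < σ₀ →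
    ∀ (Φ : (N : ℕ) → Flow σ N) (β : ℝ), 0 < β → ∀ ε : ℝ, 0 < ε →
      ∃ V₀ : ℝ, 0 < V₀ ∧ ∀ V : ℝ, V₀ ≤ V → ∃ τ₀ : ℝ, 0 < τ₀ ∧ ∀ τ : ℝ, τ₀ ≤ τ →
        ∃ N₀ : ℕ, ∀ N : ℕ, N₀ ≤ N →
          (let w : ℝ := window τ N
           let P := gibbs σ a₀ θ₀ u₀ N (Φ N)
           let act := fun (i : Fin (N + 1)) (z : Config (N + 1) (Fin 3) T3) =>
             σ / τ * (Φ N).collisionSum (Set.Ioc 0 w)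
               (fun c => if c.fst = i then ‖c.postVel.1 - c.preVel.1‖ else 0) z
           ∫⁻ z, ENNReal.ofReal (Real.exp (β * ∑ i : Fin (N + 1),
               (if V < act i z then (1 : ℝ) else 0) *
                 (1 + w⁻¹ * ∫ r in (0 : ℝ)..w, ‖((Φ N).flow r z i).2‖ ^ 2))) ∂P
             ≤ ENNReal.ofReal (Real.exp (ε * ((N : ℝ) + 1))))

end

end Summit.AtomisticToContinuum.HydrodynamicLimit.Cruxes.EquilibriumFastWindowLD.Ideas
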